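import Literature.NumberTheory.EllipticCurves.KatoRankBound
import Literature.NumberTheory.EllipticCurves.PAdicBSD
import Literature.NumberTheory.EllipticCurves.PAdicBSDInterpolationProofs
import Literature.NumberTheory.EllipticCurves.IwasawaLeadingTermProofs
import Literature.NumberTheory.EllipticCurves.LeadingTermPPartProofs
import Literature.NumberTheory.EllipticCurves.AnalyticRankOrderProofs
import Literature.NumberTheory.EllipticCurves.CuspFormLFunctionAnalyticRankProofs
import Literature.NumberTheory.EllipticCurves.ZpCorankQuasiIso
import Literature.NumberTheory.EllipticCurves.BSDSelmerParityDokchitserProofs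
import Literature.NumberTheory.EllipticCurves.PAdicBSDKatoFiniteProofs
import HarnessLib

/-!
# Kato's bound `corank Sel_{p^∞}(E/ℚ) ≤ ord_{T=0} L_p(E,T)` at every prime: the level-zero case

Theorems only (no new facts). Third proof file serving the named fact
`Literature.NumberTheory.EllipticCurves.kato_selmerCorank_le_order_padicLFunction_allPrimes`
(K. Kato, *`p`-adic Hodge theory and values of zeta functions of modular forms*, Astérisque 295
(2004), Thm. 18.4, p. 281, `k = 2`, `K = ℚ`, non-exceptional clause, every good ordinary prime
`p`, `p = 2` included), after `KatoRankBoundAllPrimesProofs` (the fact from Kato's Thm. 17.4 (1)(2)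
at `p`) and `KatoRankBoundAllPrimesSkeletonProofs` (Thm. 17.4 (1)(2) at `p` from the four
cohomological inputs of §17.13).

This file settles the fact in **level zero** — `ord_{T=0} L_p(E,T) = 0`, equivalently
`L(E,1) ≠ 0`, equivalently `ord_{s=1} L(E,s) = 0` — at EVERY good ordinary prime, from Kato's
finite-level theorem instead of the `Λ`-adic one: Cor. 14.3 (p. 235; `A = E`, `K = ℚ`, `χ = 1`),
"`L(E,1) ≠ 0 ⇒ E(ℚ)` and `Sel(ℚ, E)` finite", the tree's named fact `kato_finite_of_L_one_ne_zero W p`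
(parity-free; reduced in the tree to Gross–Zagier–Kolyvagin, bsd.S17, by
`kato_finite_of_L_one_ne_zero_of_rank_eq_analyticRank`, and to five printed leaves by
`kato_finite_of_L_one_ne_zero_of_kolyvagin`, files `PAdicBSDKatoFinite(Kolyvagin)Proofs`).

* `one_sub_unitRoot_inv_ne_zero` — a good ordinary prime is never exceptional: `1 - α⁻¹ ≠ 0`
  (`1 - α⁻¹ = u · #Ẽ(𝔽_p)`, `exists_unit_one_sub_unitRoot_inv`).
* `constantCoeff_padicLFunction_ne_zero_iff`, `order_padicLFunction_eq_zero_iff`,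
  `order_padicLFunction_eq_zero_iff_analyticRank_eq_zero`, `one_le_order_padicLFunction_iff` —
  `L_p(E,0) ≠ 0 ↔ L(E,1) ≠ 0 ↔ r_an = 0` by the PROVED interpolation theorem
  `L_p(E,0) = (1 - α⁻¹)² [0]⁺_f` (`constantCoeff_padicLFunction_unitRoot`, Mazur–Tate–Teitelbaum
  1986, §I.14 (14.3)) and `[0]⁺_f · Ω⁺_f = L(E,1)`, `Ω⁺_f > 0`
  (`IsNewformOf.entireLFunction_one_eq`, `IsNewformOf.ratPlusSymbol_zero_mul_plusPeriod`,
  `IsNewform0.plusPeriod_pos_holds`). (The same computation is done on the summit side in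
  `Summits/BirchSwinnertonDyer/…/Theorems/PAdicOrderV2PadicBSDrankLevelZero.lean`; it is repeated
  here because Literature may not import Summits.)
* `selmerCorank_eq_zero_of_entireLFunction_one_ne_zero` — Cor. 14.3 ⇒ `corank_{ℤ_p} Sel_{p^∞} = 0`.
* `kato_selmerCorank_le_order_padicLFunction_allPrimes_of_entireLFunction_one_ne_zero`,
  `…_of_analyticRank_eq_zero`, `…_of_order_eq_zero` — **Thm. 18.4 at every prime for curves of
  analytic rank `0`**, from Cor. 14.3 alone.
* `kato_selmerCorank_le_order_padicLFunction_allPrimes_of_vanishing` — what is left of the fact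
  after this file: its restriction to curves with `L(E,1) = 0`, where `1 ≤ ord_{T=0} L_p(E,T)`
  (the case carried by Kato's `Λ`-adic Thm. 17.4 (1)(2) at `p`, see `KatoRankBoundAllPrimesProofs`).

References: K. Kato, Astérisque 295 (2004), Thm. 14.2 (2), Cor. 14.3 (p. 235), Thm. 18.4 (p. 281);
B. Mazur, J. Tate, J. Teitelbaum, Invent. Math. 84 (1986), §I.14 (14.3).
-/

open scoped MatrixGroups ModularForm

open CongruenceSubgroup Literature.NumberTheory.EllipticCurves.ModularForms

namespace Literature.NumberTheory.EllipticCurves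

section LevelZero

variable (W : WeierstrassCurve ℚ) [W.IsElliptic] [W.IsGloballyMinimal] (p : ℕ) [Fact p.Prime]
  {N : ℕ} [NeZero N] {f : CuspForm (Gamma0 N) 2}

omit [W.IsElliptic] in
/-- **A good ordinary prime is not exceptional: `1 - α⁻¹ ≠ 0`** for `α = unitRoot W p`, since
`1 - α⁻¹ = u · #Ẽ(𝔽_p)` with `u ∈ ℤ_pˣ` (`exists_unit_one_sub_unitRoot_inv`) and `#Ẽ(𝔽_p) ≥ 1`
(`reductionPointCount_pos`). Mazur–Tate–Teitelbaum 1986, §I.14 (the Euler-type factor of (14.3)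
at the trivial character). [cite: MazurTateTeitelbaum1986Invent, §I.14 (14.3)] -/
theorem one_sub_unitRoot_inv_ne_zero (hord : IsOrdinaryAt W p) :
    (1 : ℚ_[p]) - ((unitRoot W p : ℤ_[p]) : ℚ_[p])⁻¹ ≠ 0 := by
  haveI : NeZero p := ⟨(Fact.out : p.Prime).ne_zero⟩
  obtain ⟨u, hu⟩ := exists_unit_one_sub_unitRoot_inv p W hord
  rw [hu]
  refine mul_ne_zero (coe_units_ne_zero p u) ?_
  exact_mod_cast (W.reductionPointCount_pos p).ne'

/-- **`L_p(E,0) ≠ 0 ↔ L(E,1) ≠ 0`** at a good ordinary prime `p` (`p = 2` included), for the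
newform `f` of `E/ℚ` (globally minimal `W`): the constant term of
`L_p(E,T) = padicLFunction f (unitRoot W p)` is `(1 - α⁻¹)² [0]⁺_f`
(`constantCoeff_padicLFunction_unitRoot`), `1 - α⁻¹ ≠ 0` (`one_sub_unitRoot_inv_ne_zero`), and
`L(E,1) = [0]⁺_f · Ω⁺_f` with `Ω⁺_f > 0` (`IsNewformOf.entireLFunction_one_eq`,
`IsNewformOf.ratPlusSymbol_zero_mul_plusPeriod`, `IsNewform0.plusPeriod_pos_holds`).
[cite: MazurTateTeitelbaum1986Invent, §I.14 (14.3)] -/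
theorem constantCoeff_padicLFunction_ne_zero_iff (hord : IsOrdinaryAt W p)
    (hf : IsNewformOf W f) :
    PowerSeries.constantCoeff (padicLFunction f (unitRoot W p : ℚ_[p])) ≠ 0 ↔
      W.entireLFunction 1 ≠ 0 := by
  rw [constantCoeff_padicLFunction_unitRoot hord hf]
  have hpos : 0 < plusPeriod f := IsNewform0.plusPeriod_pos_holds hf.1 hf.coeffField_eq_bot
  constructor
  · intro hc hL
    apply hc
    have hsym : ratPlusSymbol f 0 = 0 := by
      have h1 := hf.ratPlusSymbol_zero_mul_plusPeriod
      rw [hL, Complex.zero_re] at h1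
      have h2 : ((ratPlusSymbol f 0 : ℚ) : ℝ) = 0 := (mul_eq_zero.mp h1).resolve_right hpos.ne'
      exact_mod_cast h2
    rw [hsym, Rat.cast_zero, mul_zero]
  · intro hL
    have hsym : (ratPlusSymbol f 0 : ℚ) ≠ 0 := by
      intro h
      apply hL
      rw [hf.entireLFunction_one_eq, h]
      simp
    exact mul_ne_zero (pow_ne_zero _ (one_sub_unitRoot_inv_ne_zero W p hord))
      (by exact_mod_cast hsym)

/-- **`ord_{T=0} L_p(E,T) = 0 ↔ L(E,1) ≠ 0`** at a good ordinary prime `p` (`p = 2` included):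
the order of a power series is `0` iff its constant coefficient is non-zero, and
`L_p(E,0) ≠ 0 ↔ L(E,1) ≠ 0` (`constantCoeff_padicLFunction_ne_zero_iff`).
[cite: MazurTateTeitelbaum1986Invent, §I.14 (14.3)] -/
theorem order_padicLFunction_eq_zero_iff (hord : IsOrdinaryAt W p) (hf : IsNewformOf W f) :
    (padicLFunction f (unitRoot W p : ℚ_[p])).order = 0 ↔ W.entireLFunction 1 ≠ 0 := by
  rw [← constantCoeff_padicLFunction_ne_zero_iff W p hord hf,
    ← PowerSeries.coeff_zero_eq_constantCoeff_apply]
  have h0 : ((0 : ℕ) : ℕ∞) = 0 := Nat.cast_zero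
  rw [← h0, PowerSeries.order_eq_nat]
  exact ⟨fun h ↦ h.1, fun h ↦ ⟨h, fun i hi ↦ absurd hi (Nat.not_lt_zero i)⟩⟩

/-- **`ord_{T=0} L_p(E,T) = 0 ↔ ord_{s=1} L(E,s) = 0`** at a good ordinary prime `p`
(`p = 2` included): `order_padicLFunction_eq_zero_iff` and `r_an = 0 ↔ L(E,1) ≠ 0`
(`analyticRank_eq_zero_iff_holds`; `L(E,s)` is entire for the modular `E`,
`IsNewformOf.hasEntireLFunction`). [cite: MazurTateTeitelbaum1986Invent, §I.14 (14.3)] -/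
theorem order_padicLFunction_eq_zero_iff_analyticRank_eq_zero (hord : IsOrdinaryAt W p)
    (hf : IsNewformOf W f) :
    (padicLFunction f (unitRoot W p : ℚ_[p])).order = 0 ↔ W.analyticRank = 0 :=
  (order_padicLFunction_eq_zero_iff W p hord hf).trans
    (W.analyticRank_eq_zero_iff_holds hf.hasEntireLFunction).symm

/-- **`1 ≤ ord_{T=0} L_p(E,T) ↔ L(E,1) = 0`** at a good ordinary prime `p` (`p = 2` included):
the complement of `order_padicLFunction_eq_zero_iff`.
[cite: MazurTateTeitelbaum1986Invent, §I.14 (14.3)] -/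
theorem one_le_order_padicLFunction_iff (hord : IsOrdinaryAt W p) (hf : IsNewformOf W f) :
    1 ≤ (padicLFunction f (unitRoot W p : ℚ_[p])).order ↔ W.entireLFunction 1 = 0 := by
  rw [Order.one_le_iff_ne_zero, Ne, order_padicLFunction_eq_zero_iff W p hord hf, not_not]

omit [W.IsElliptic] [W.IsGloballyMinimal] in
/-- **Kato Cor. 14.3 ⇒ `corank_{ℤ_p} Sel_{p^∞}(E/ℚ) = 0` when `L(E,1) ≠ 0`**, at every prime `p`:
granting `kato_finite_of_L_one_ne_zero W p` ("`L(E,1) ≠ 0 ⇒ E(ℚ)`, `Ш(E/ℚ)[p^∞]`,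
`Sel_{p^∞}(E/ℚ)` finite", Kato 2004, Thm. 14.2 (2) / Cor. 14.3, p. 235), a finite group has
`ℤ_p`-corank `0` (`zpCorank_of_finite_eq_zero`). [cite: Kato2004Asterisque, Cor. 14.3 (p. 235)] -/
theorem selmerCorank_eq_zero_of_entireLFunction_one_ne_zero
    (hKF : kato_finite_of_L_one_ne_zero W p) (hL : W.entireLFunction 1 ≠ 0) :
    W.selmerCorank p = 0 := by
  obtain ⟨-, -, hfin⟩ := hKF hL
  haveI := hfin
  unfold WeierstrassCurve.selmerCorank
  exact zpCorank_of_finite_eq_zero p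

/-- **`ord_{T=0} L_p(E,T) = 0 ⇒ corank_{ℤ_p} Sel_{p^∞}(E/ℚ) = 0`** at a good ordinary prime `p`
(`p = 2` included), granting Kato's Cor. 14.3 (`kato_finite_of_L_one_ne_zero W p`): the level
`ord_T L_p = 0` reads `L(E,1) ≠ 0` (`order_padicLFunction_eq_zero_iff`), and then `Sel_{p^∞}(E/ℚ)`
is finite. [cite: Kato2004Asterisque, Cor. 14.3 (p. 235) and Thm. 18.4 (p. 281)] -/
theorem selmerCorank_eq_zero_of_order_padicLFunction_eq_zero
    (hKF : kato_finite_of_L_one_ne_zero W p) (hord : IsOrdinaryAt W p) (hf : IsNewformOf W f)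
    (h0 : (padicLFunction f (unitRoot W p : ℚ_[p])).order = 0) : W.selmerCorank p = 0 :=
  selmerCorank_eq_zero_of_entireLFunction_one_ne_zero W p hKF
    ((order_padicLFunction_eq_zero_iff W p hord hf).mp h0)

omit [W.IsElliptic] in
/-- **Kato's Thm. 18.4 at EVERY good ordinary prime for a curve with `L(E,1) ≠ 0`**, from
Cor. 14.3 alone: if `L(E,1) ≠ 0` then `Sel_{p^∞}(E/ℚ)` is finite (`kato_finite_of_L_one_ne_zero`),
so `corank_{ℤ_p} Sel_{p^∞}(E/ℚ) = 0 ≤ ord_{T=0} L_p(E,T)`, i.e.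
`kato_selmerCorank_le_order_padicLFunction_allPrimes W p` holds for this `W` (any `p`, `p = 2`
included). [cite: Kato2004Asterisque, Cor. 14.3 (p. 235) and Thm. 18.4 (p. 281)] -/
theorem kato_selmerCorank_le_order_padicLFunction_allPrimes_of_entireLFunction_one_ne_zero
    (hKF : kato_finite_of_L_one_ne_zero W p) (hL : W.entireLFunction 1 ≠ 0) :
    kato_selmerCorank_le_order_padicLFunction_allPrimes W p (f := f) := by
  intro _ _
  rw [selmerCorank_eq_zero_of_entireLFunction_one_ne_zero W p hKF hL, Nat.cast_zero]
  exact zero_le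

/-- **Kato's Thm. 18.4 at EVERY good ordinary prime in analytic rank `0`**, from Cor. 14.3
alone: `r_an(E) = 0` reads `L(E,1) ≠ 0` for the modular `E` (`analyticRank_eq_zero_iff_holds`,
`IsNewformOf.hasEntireLFunction`), and then
`kato_selmerCorank_le_order_padicLFunction_allPrimes_of_entireLFunction_one_ne_zero` applies.
[cite: Kato2004Asterisque, Cor. 14.3 (p. 235) and Thm. 18.4 (p. 281)] -/
theorem kato_selmerCorank_le_order_padicLFunction_allPrimes_of_analyticRank_eq_zero
    (hKF : kato_finite_of_L_one_ne_zero W p) (hr : W.analyticRank = 0) :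
    kato_selmerCorank_le_order_padicLFunction_allPrimes W p (f := f) := by
  intro hord hf
  have hL : W.entireLFunction 1 ≠ 0 :=
    (W.analyticRank_eq_zero_iff_holds hf.hasEntireLFunction).mp hr
  exact kato_selmerCorank_le_order_padicLFunction_allPrimes_of_entireLFunction_one_ne_zero W p
    hKF hL hord hf

/-- **Kato's Thm. 18.4 at EVERY good ordinary prime in level zero**, from Cor. 14.3 alone: if
`ord_{T=0} L_p(E,T) = 0` for the newform `f` of `E` then `L(E,1) ≠ 0`
(`order_padicLFunction_eq_zero_iff`) and the conclusion of
`kato_selmerCorank_le_order_padicLFunction_allPrimes W p` holds (indeed with equality,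
`corank_{ℤ_p} Sel_{p^∞}(E/ℚ) = 0 = ord_{T=0} L_p(E,T)`).
[cite: Kato2004Asterisque, Cor. 14.3 (p. 235) and Thm. 18.4 (p. 281)] -/
theorem selmerCorank_le_order_padicLFunction_of_order_eq_zero
    (hKF : kato_finite_of_L_one_ne_zero W p) (hord : IsOrdinaryAt W p) (hf : IsNewformOf W f)
    (h0 : (padicLFunction f (unitRoot W p : ℚ_[p])).order = 0) :
    (W.selmerCorank p : ℕ∞) ≤ (padicLFunction f (unitRoot W p : ℚ_[p])).order := by
  rw [selmerCorank_eq_zero_of_order_padicLFunction_eq_zero W p hKF hord hf h0, Nat.cast_zero]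
  exact zero_le

/-- **What is left of Kato's Thm. 18.4 at the prime `p` after the level-zero case.** Granting
Cor. 14.3 (`kato_finite_of_L_one_ne_zero W p`), the named fact
`kato_selmerCorank_le_order_padicLFunction_allPrimes W p` follows from its restriction `hpos` to
the case `L(E,1) = 0`, in which `1 ≤ ord_{T=0} L_p(E,T)` automatically
(`one_le_order_padicLFunction_iff`); that remaining case is the content of Kato's `Λ`-adic
Thm. 17.4 (1)(2) at `p` (`kato_selmerCorank_le_order_padicLFunction_allPrimes_of_divisibility`,
file `KatoRankBoundAllPrimesProofs`). [cite: Kato2004Asterisque, Cor. 14.3 (p. 235) and Thm. 18.4 (p. 281)] -/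
theorem kato_selmerCorank_le_order_padicLFunction_allPrimes_of_vanishing
    (hKF : kato_finite_of_L_one_ne_zero W p)
    (hpos : W.entireLFunction 1 = 0 → ∀ (hord : IsOrdinaryAt W p) (hf : IsNewformOf W f),
      1 ≤ (padicLFunction f (unitRoot W p : ℚ_[p])).order →
        (W.selmerCorank p : ℕ∞) ≤ (padicLFunction f (unitRoot W p : ℚ_[p])).order) :
    kato_selmerCorank_le_order_padicLFunction_allPrimes W p (f := f) := by
  intro hord hf
  by_cases hL : W.entireLFunction 1 = 0
  · exact hpos hL hord hf ((one_le_order_padicLFunction_iff W p hord hf).mpr hL)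
  · exact kato_selmerCorank_le_order_padicLFunction_allPrimes_of_entireLFunction_one_ne_zero W p
      hKF hL hord hf

end LevelZero

/-! ### Analytic rank `≤ 1`: Kato's Thm. 18.4 at every prime from Gross–Zagier–Kolyvagin

If `ord_{s=1} L(E,s) ≤ 1` then (bsd.S17, Gross–Zagier 1986 + Kolyvagin 1990, stated as Darmon 2004,
Thm. 3.22; the tree's named fact `rank_eq_analyticRank_of_analyticRank_le_one`, parity-free)
`rank E(ℚ) = ord_{s=1} L(E,s)` and `Ш(E/ℚ)` is finite, so
`corank_{ℤ_p} Sel_{p^∞}(E/ℚ) = ord_{s=1} L(E,s)` for EVERY prime `p`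
(`selmerCorank_eq_analyticRank_of_analyticRank_le_one`). In analytic rank `1`, `L(E,1) = 0` and
the interpolation formula gives `1 ≤ ord_{T=0} L_p(E,T)` (`one_le_order_padicLFunction_iff`).
Hence Kato's inequality `corank Sel_{p^∞}(E/ℚ) ≤ ord_{T=0} L_p(E,T)` — and its Mordell–Weil form
`rank E(ℚ) ≤ ord_{T=0} L_p(E,T)` — hold at every good ordinary prime, `p = 2` included, for all
curves of analytic rank `≤ 1`, from Gross–Zagier–Kolyvagin alone; what is left of the named fact
`kato_selmerCorank_le_order_padicLFunction_allPrimes` is the case `ord_{s=1} L(E,s) ≥ 2`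
(`kato_selmerCorank_le_order_padicLFunction_allPrimes_of_two_le_analyticRank`), which is the case
its summit-side consumer needs at `p = 2` (crux `PAdicOrderPadicBSDrankR2`, "from rank `2` on").
-/

section AnalyticRankLeOne

variable (W : WeierstrassCurve ℚ) [W.IsElliptic] [W.IsGloballyMinimal] (p : ℕ) [Fact p.Prime]
  {N : ℕ} [NeZero N] {f : CuspForm (Gamma0 N) 2}

/-- **Kato's Thm. 18.4 at EVERY good ordinary prime in analytic rank `≤ 1`, from
Gross–Zagier–Kolyvagin.** If `ord_{s=1} L(E,s) ≤ 1` (`hr`) then, granting bsd.S17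
(`rank_eq_analyticRank_of_analyticRank_le_one`), `corank_{ℤ_p} Sel_{p^∞}(E/ℚ) = ord_{s=1} L(E,s)`
(`selmerCorank_eq_analyticRank_of_analyticRank_le_one`); in analytic rank `0` the inequality is
trivial and in analytic rank `1`, `L(E,1) = 0` (`analyticRank_eq_zero_iff_holds`) gives
`1 ≤ ord_{T=0} L_p(E,T)` (`one_le_order_padicLFunction_iff`). So
`kato_selmerCorank_le_order_padicLFunction_allPrimes W p` holds for this `W` at every good ordinary
`p`, `p = 2` included. [cite: Darmon2004, Thm. 3.22] [cite: Kato2004Asterisque, Thm. 18.4 (p. 281)] -/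
theorem kato_selmerCorank_le_order_padicLFunction_allPrimes_of_analyticRank_le_one
    (hGZK : rank_eq_analyticRank_of_analyticRank_le_one) (hr : W.analyticRank ≤ 1) :
    kato_selmerCorank_le_order_padicLFunction_allPrimes W p (f := f) := by
  intro hord hf
  have hcork : W.selmerCorank p = W.analyticRank :=
    selmerCorank_eq_analyticRank_of_analyticRank_le_one hGZK W p hr
  rcases Nat.le_one_iff_eq_zero_or_eq_one.mp hr with h0 | h1
  · rw [hcork, h0, Nat.cast_zero]
    exact zero_le
  · have hL : W.entireLFunction 1 = 0 := by
      by_contra hL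
      have h0 : W.analyticRank = 0 := (W.analyticRank_eq_zero_iff_holds hf.hasEntireLFunction).mpr hL
      omega
    rw [hcork, h1, Nat.cast_one]
    exact (one_le_order_padicLFunction_iff W p hord hf).mpr hL

/-- **The Mordell–Weil form of Kato's Thm. 18.4 ("In particular") at EVERY good ordinary prime in
analytic rank `≤ 1`, from Gross–Zagier–Kolyvagin**: `rank E(ℚ) = ord_{s=1} L(E,s) ≤ 1`
(bsd.S17), and in analytic rank `1`, `1 ≤ ord_{T=0} L_p(E,T)` (`one_le_order_padicLFunction_iff`).
[cite: Darmon2004, Thm. 3.22] [cite: Kato2004Asterisque, Thm. 18.4 (p. 281)] -/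
theorem mordellWeilRank_le_order_padicLFunction_of_analyticRank_le_one
    (hGZK : rank_eq_analyticRank_of_analyticRank_le_one) (hr : W.analyticRank ≤ 1)
    (hord : IsOrdinaryAt W p) (hf : IsNewformOf W f) :
    (W.mordellWeilRank : ℕ∞) ≤ (padicLFunction f (unitRoot W p : ℚ_[p])).order := by
  have hrank : W.mordellWeilRank = W.analyticRank := (hGZK W hr).1
  rcases Nat.le_one_iff_eq_zero_or_eq_one.mp hr with h0 | h1
  · rw [hrank, h0, Nat.cast_zero]
    exact zero_le
  · have hL : W.entireLFunction 1 = 0 := by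
      by_contra hL
      have h0 : W.analyticRank = 0 := (W.analyticRank_eq_zero_iff_holds hf.hasEntireLFunction).mpr hL
      omega
    rw [hrank, h1, Nat.cast_one]
    exact (one_le_order_padicLFunction_iff W p hord hf).mpr hL

/-- **Both vendored odd-`p` forms of Kato's Thm. 18.4** (`kato_selmerCorank_le_order_padicLFunction`,
`kato_mordellWeilRank_le_order_padicLFunction`, file `KatoRankBound`) **hold for a curve of analytic
rank `≤ 1` from Gross–Zagier–Kolyvagin** (at every prime; the parity binder is not used).
[cite: Darmon2004, Thm. 3.22] [cite: Kato2004Asterisque, Thm. 18.4 (p. 281)] -/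
theorem kato_rankBounds_of_analyticRank_le_one
    (hGZK : rank_eq_analyticRank_of_analyticRank_le_one) (hr : W.analyticRank ≤ 1) :
    kato_selmerCorank_le_order_padicLFunction W p (f := f) ∧
      kato_mordellWeilRank_le_order_padicLFunction W p (f := f) :=
  ⟨fun _ hord hf ↦
      kato_selmerCorank_le_order_padicLFunction_allPrimes_of_analyticRank_le_one W p hGZK hr hord hf,
    fun _ hord hf ↦ mordellWeilRank_le_order_padicLFunction_of_analyticRank_le_one W p hGZK hr hord hf⟩

/-- **What is left of Kato's Thm. 18.4 at the prime `p` after Gross–Zagier–Kolyvagin: analytic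
rank `≥ 2`.** Granting bsd.S17 (`hGZK`), the named fact
`kato_selmerCorank_le_order_padicLFunction_allPrimes W p` follows from its restriction `hres` to
curves with `ord_{s=1} L(E,s) ≥ 2` (where `1 ≤ ord_{T=0} L_p(E,T)` by
`one_le_order_padicLFunction_iff`, but nothing more is known here); that case is the content of
Kato's `Λ`-adic Thm. 17.4 (1)(2) at `p` (`kato_selmerCorank_le_order_padicLFunction_allPrimes_of_divisibility`,
file `KatoRankBoundAllPrimesProofs`), vendored at odd `p` only (`kato_divisibility`).
[cite: Darmon2004, Thm. 3.22] [cite: Kato2004Asterisque, Thm. 17.4 (1)(2) (p. 273) and Thm. 18.4 (p. 281)] -/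
theorem kato_selmerCorank_le_order_padicLFunction_allPrimes_of_two_le_analyticRank
    (hGZK : rank_eq_analyticRank_of_analyticRank_le_one)
    (hres : 2 ≤ W.analyticRank → ∀ (hord : IsOrdinaryAt W p) (hf : IsNewformOf W f),
      (W.selmerCorank p : ℕ∞) ≤ (padicLFunction f (unitRoot W p : ℚ_[p])).order) :
    kato_selmerCorank_le_order_padicLFunction_allPrimes W p (f := f) := by
  intro hord hf
  by_cases hr : W.analyticRank ≤ 1
  · exact kato_selmerCorank_le_order_padicLFunction_allPrimes_of_analyticRank_le_one W p hGZK hr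
      hord hf
  · exact hres (by omega) hord hf

end AnalyticRankLeOne

end Literature.NumberTheory.EllipticCurves
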